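import Summits.ABC.IUTFork.Conditional.AbcOfSGenuineKLinUniformRows6
import Summits.ABC.IUTFork.Conditional.AbcOfSGenuineMLinUniformHarvest1
import HarnessLib

/-!
# M LINE: R-W N3 rows DECIDED (refuted side, S_H level at the M-level sharp setting) UNCONDITIONALLY by the local-type-uniform [LIN] test — HARVEST part 11
# (1 known abc triples, 1 (triple, l) pairs of HOME/plan/rescue/R-W/TE30-CENSUS.tsv v2)

PROOF-ONLY file (no `def`, no new `Prop`, no instance) of the abc-iut cell (W6 prover seat abc-iut-w6-d108, gen 5; R-W lane P−/U row
«W:LINU-HARVEST» = abc-iut-rw-num-lead's LIN-UNIFORM HARVEST LIST, HOME/STATUS 2026-08-26T20:16:17Z: «your e-free decider p464182 fires on 1,907 of the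
2,158 Szpiro-BAD admissible (known triple, l) pairs of N3 … 1,800 MORE kernel rows available NOW by one 'exact' each — per-row (p, v, B, i₀) in
HOME/plan/rescue/R-W/TE30-CENSUS.tsv v2 4aacf04dd720d649 columns linu/linu_decidable»). TAKES NO SIDE on [IUTchIII] Cor. 3.12 or on any author.
M TWIN of this seat's K-line files `AbcOfSGenuineKLinUniformHarvest1–8` (p469692 … p469861; same tables). NO new engine: every row is ONE application of
abc-iut-w5-d107's `GenuineM.not_pilotKummerCompatHull_triple_of_linUniform` (`AbcOfSGenuineMLinUniformTriple`, p466242: abc-iut-s2-p8's M-level sharp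
setting `settingPrVolSharpM` of the datum's own read-off ideles `tqM`, pinned reading; `u` a finite place of `ℚ` with `p_u ∉ {2, 3, 5, l}`, `p_u^v ∣ abc`,
`30·l < p_u^B·(p_u−1)`, `j = i₀+1 ≤ l⋆` and the same integer test ⇒ ¬S_H at EVERY genuine Θ-volume datum over `(ratPoint (a/c), l)`), packaged through the M
table master `GenuineM.not_pilotKummerCompatHull_triple_of_linUniform_table` (M part 1): ONE theorem per (triple, pole prime `p`), hypothesis
`l ∈ [l₁, …, l_k]` = every Szpiro-bad admissible `l` of the census at which the test passes, the certificate table `(l, p, v, B, i₀)` copied from the census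
and RE-CHECKED in the kernel by `fin_cases` + `norm_num` (and at the desk by an independent third implementation, this seat's work/gen_harvest.py —
rw-num-lead's engines A/B being the first two). The abc-triple lemmas are REUSED BY NAME from abc-iut-w5-d107 / abc-iut-W-ref-2 / abc-iut-w5-d236's rows
files where they exist. Rows of this part: `frey-3^4*23^6*1013^2+2^47*5^3*19^2=7*131^7*1373` (1 l).
HONEST SCOPE as in p466242 / p464182: SHARP reading (Θ-possible-image set constant in `m`, typed (Ind1)/(Ind2) = Dupuy–Hilado families); per-label licence STRONGER
than print; admissibility / Szpiro-badness / (P6) / non-emptiness of the datum type NOT claimed (apex assemblers' inputs, `Conditional.not_hSHwBad_of_refuted`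
p465583); «refuted as typed» ≠ «refuted in print»; nothing about the number-level Corollary; typed ≠ proved; instantiated ≠ endorsed.
[cite: Mochizuki2012, IUTchIII Cor. 3.12 Step (xi-f) p. 184; IUTchIV Prop. 1.2 p. 10, Cor. 2.2 (ii) proof p. 44–46] [cite: MochizukiGenEll2010, Thm. 2.1 p. 11]
[claim: Mochizuki2012, status: disputed] for every IUT sentence quoted.
-/

noncomputable section

open Set Function NumberField IsDedekindDomain

namespace Summit.ABC.IUTFork.Conditional

open Thm311 Thm311.Real Cor312 Cor312Vol Cor312Prov Literature.IUT.LogThetaLattice Literature.IUT.LogVolume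
  Literature.IUT.HodgeTheaters Literature.IUT.LogVolume.ThetaData Literature.IUT.LogVolume.Cor22
open Literature.NumberTheory.NumberFields Literature.NumberTheory.GaloisRepresentations.Ultrametric
open Literature.NumberTheory.DiophantineGeometry Literature.NumberTheory.DiophantineGeometry.GenEll Summit.ABC.ABC.Theorems

/-! ## §1. M-line rows (one theorem per known abc triple and pole prime) -/

/-- **M LINE, R-W N3 ROWS `frey-3^4*23^6*1013^2+2^47*5^3*19^2=7*131^7*1373` over `p = 131` — REFUTED side, UNCONDITIONALLY, by the local-type-uniform [LIN] test at the
1 Szpiro-bad admissible primes** `l ∈` {19} (rows of HOME/plan/rescue/R-W/TE30-CENSUS.tsv v2 with `linu_decidable = Y`; table rows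
`(l, p, v, B, i₀)`, j = i₀+1; `p = 131`, `v = 7` (all rows)): for every finite place `u` of `ℚ` with `p_u = 131` and every genuine Θ-volume datum `T` over `(ratPoint (a/c), l)`, the
hull-level clause S_H at the M-level sharp setting of `T`'s own read-off ideles (pinned reading) FAILS for every choice of the free context binders and Kummer
datum (M twin of the K-line `GenuineK.not_pilotKummerCompatHull_chosen_frey12304697054518521_linu`). NOT claimed: admissibility / Szpiro-badness / (P6) / non-emptiness.
[cite: Mochizuki2012, IUTchIII Cor. 3.12 Step (xi-f) p. 184] [claim: Mochizuki2012, status: disputed] -/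
theorem GenuineM.not_pilotKummerCompatHull_frey12304697054518521_p131_linu {l : ℕ}
    (hl : l ∈ [19])
    (T : Cor22.ThetaVolumeDatumAt (ratPoint (((3 ^ 4 * 23 ^ 6 * 1013 ^ 2 : ℕ) : ℚ) / (7 * 131 ^ 7 * 1373 : ℕ))) l) (u : FinitePlace ℚ) (hu : ratChar u = 131) :
    letI := T.instFieldF; letI := T.instNumberFieldF; letI := T.instAlgebraF; letI := T.instFieldK
    letI := T.instNumberFieldK; letI := T.instAlgebraK; letI := T.instFieldFbar; letI := T.instAlgebraFbar
    letI := T.instAlgebraKFbar; letI := T.instIsElliptic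
    ∀ (M : Type) [Field M] [NumberField M]
      (archPk : ∀ (j : (thetaIndexOfInitial T.D).Label) (vQ : (thetaIndexOfInitial T.D).VQ),
        Set ((logShellsOfInitialDH T.D (analyticLogvVal T.K)).Packet j vQ))
      (archSub : ∀ (j : (thetaIndexOfInitial T.D).Label) (v : (thetaIndexOfInitial T.D).V),
        Set ((logShellsOfInitialDH T.D (analyticLogvVal T.K)).Packet j ((thetaIndexOfInitial T.D).over v)))
      (Ψ : ℤ → ∀ v : (thetaIndexOfInitial T.D).V, v ∈ (thetaIndexOfInitial T.D).Vbad →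
        Set ((logShellsOfInitialDH T.D (analyticLogvVal T.K)).StarPacket v))
      (act : ℤ → ∀ v : (thetaIndexOfInitial T.D).V, v ∈ (thetaIndexOfInitial T.D).Vbad →
        (logShellsOfInitialDH T.D (analyticLogvVal T.K)).StarPacket v →
          Module.End ℚ ((logShellsOfInitialDH T.D (analyticLogvVal T.K)).StarPacket v))
      (Mmod : ℤ → ∀ j : (thetaIndexOfInitial T.D).LabelStar, Set ((logShellsOfInitialDH T.D (analyticLogvVal T.K)).GlobalPacket j.1))
      (region : ℤ → ∀ j : (thetaIndexOfInitial T.D).LabelStar, FinDivisor M → ∀ vQ : (thetaIndexOfInitial T.D).VQ,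
        Set ((logShellsOfInitialDH T.D (analyticLogvVal T.K)).Packet j.1 vQ))
      (frobAdm : ℤ → ℤ → ∀ (j : (thetaIndexOfInitial T.D).Label) (vQ : (thetaIndexOfInitial T.D).VQ),
        Set ((logShellsOfInitialDH T.D (analyticLogvVal T.K)).Packet j vQ) → Prop)
      (frobLogvol : ℤ → ℤ → ∀ (j : (thetaIndexOfInitial T.D).Label) (vQ : (thetaIndexOfInitial T.D).VQ),
        Set ((logShellsOfInitialDH T.D (analyticLogvVal T.K)).Packet j vQ) → ℝ)
      (frobΨ : ℤ → ℤ → ∀ v : (thetaIndexOfInitial T.D).V, v ∈ (thetaIndexOfInitial T.D).Vbad →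
        Set ((logShellsOfInitialDH T.D (analyticLogvVal T.K)).StarPacket v))
      (frobMmod : ℤ → ℤ → ∀ j : (thetaIndexOfInitial T.D).LabelStar, Set ((logShellsOfInitialDH T.D (analyticLogvVal T.K)).GlobalPacket j.1))
      (unitImage : ℤ → ℤ → ℕ → ∀ (j : (thetaIndexOfInitial T.D).Label) (vQ : (thetaIndexOfInitial T.D).VQ),
        Set ((logShellsOfInitialDH T.D (analyticLogvVal T.K)).Packet j vQ))
      (ballImage : ℤ → ℤ → ∀ (j : (thetaIndexOfInitial T.D).Label) (vQ : (thetaIndexOfInitial T.D).VQ),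
        Set ((logShellsOfInitialDH T.D (analyticLogvVal T.K)).Packet j vQ))
      (thetaDiv : ℤ → ℤ → LgpDivisor M (thetaIndexOfInitial T.D).lstar)
      (n : ℤ) {HT : Type} {LogLink : HT → HT → Type} {IsFull : ∀ {s t : HT}, LogLink s t → Prop}
      (lat : LGPGaussianLogThetaLattice LogLink IsFull)
      {Frd : Type} {IsoF : Frd → Frd → Type} {Ob : Frd → Type} {realify : Frd → Frd} {Strip : Type}
      {IsoS : Strip → Strip → Type} {Mv : ∀ v : (thetaIndexOfInitial T.D).V, v ∈ (thetaIndexOfInitial T.D).Vbad → Type}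
      [∀ v h, Monoid (Mv v h)]
      (sig : GlobalLGPFrobenioidSignature (thetaIndexOfInitial T.D).lstar (thetaIndexOfInitial T.D).V
        (· ∈ (thetaIndexOfInitial T.D).Vbad) Frd IsoF Ob realify Strip IsoS Mv)
      (split : SplittingMonoids Mv) {ObΔ : Type} {N : ∀ v : (thetaIndexOfInitial T.D).V, v ∈ (thetaIndexOfInitial T.D).Vbad → Type}
      [∀ v h, Monoid (N v h)] (qData : QPilotData ObΔ N)
      (qK : ∀ v : (thetaIndexOfInitial T.D).V, v ∈ (thetaIndexOfInitial T.D).Vbad →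
        Set ((logShellsOfInitialDH T.D (analyticLogvVal T.K)).StarPacket v)),
      ¬ Cor312Vol.PilotKummerCompatHull
        (LatticeSituation.ofShells (logShellsOfInitialDH T.D (analyticLogvVal T.K)) M archPk archSub
          (summandPiecesPrM T.D (logvAnalyticVal_analyticLogvVal (K := T.K))).Adm (summandPiecesPrM T.D (logvAnalyticVal_analyticLogvVal (K := T.K))).logvol Ψ act Mmod region frobAdm frobLogvol
          frobΨ frobMmod unitImage ballImage thetaDiv)
        (settingPrVolSharpM T.D (logvAnalyticVal_analyticLogvVal (K := T.K)) (tOfIdeleData T.D (ideleDataOf T.D T.isVolumeInputOf))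
          (fun u x => tqM T.D (ratChar u) u (natCast_ratChar_mem u) (ideleDataOf T.D T.isVolumeInputOf) x) M archPk archSub Ψ act Mmod region n lat sig split qData
          (fun u x => tqM_ne_zero T.D (ratChar u) u (natCast_ratChar_mem u) (ideleDataOf T.D T.isVolumeInputOf) x)
          (GenuineM.finite_ratPlaces_under_S T.D).toFinset
          (fun u x hu => norm_tqM_eq_one_of_not_mem T.D (ratChar u) u (natCast_ratChar_mem u) (ideleDataOf T.D T.isVolumeInputOf) x
            fun hx => hu ((Set.Finite.mem_toFinset _).mpr ⟨x, hx⟩)))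
        (fun _ => Cor312.Setting.qRegion
          (settingPrVolSharpM T.D (logvAnalyticVal_analyticLogvVal (K := T.K)) (tOfIdeleData T.D (ideleDataOf T.D T.isVolumeInputOf))
          (fun u x => tqM T.D (ratChar u) u (natCast_ratChar_mem u) (ideleDataOf T.D T.isVolumeInputOf) x) M archPk archSub Ψ act Mmod region n lat sig split qData
          (fun u x => tqM_ne_zero T.D (ratChar u) u (natCast_ratChar_mem u) (ideleDataOf T.D T.isVolumeInputOf) x)
          (GenuineM.finite_ratPlaces_under_S T.D).toFinset
          (fun u x hu => norm_tqM_eq_one_of_not_mem T.D (ratChar u) u (natCast_ratChar_mem u) (ideleDataOf T.D T.isVolumeInputOf) x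
            fun hx => hu ((Set.Finite.mem_toFinset _).mpr ⟨x, hx⟩)))) qK :=
  GenuineM.not_pilotKummerCompatHull_triple_of_linUniform_table isABCTriple_frey12304697054518521
    [(19, 131, 7, 1, 6)]
    (by intro r hr; fin_cases hr; norm_num) (by simpa using hl) T u hu


end Summit.ABC.IUTFork.Conditional

end
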